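import Literature.MathematicalPhysics.QuantumFieldTheory.Balaban1983to89.B9Thm31SiteGsqHessianReg335Y
import Literature.MathematicalPhysics.QuantumFieldTheory.Balaban1983to89.B9Ineq346SecondOrderTorusCutoff

/-!
# `Balaban1983to89.B9Thm31SiteBlockBumpY` — T. Bałaban, *Propagators for lattice gauge theories in a background field*, Commun. Math. Phys. **99** (1985)
# 389–434 [Balaban1985BackgroundPropagators] (3.46) p. 398 («supp h ⊂ Δ̃(y), y ∈ Λ_j»), Cor 3.6 p. 408, (3.88) p. 409; [B6] = [Balaban1984PropagatorsII] (2.2) p. 224,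
# (2.46) p. 231: **THE FIXED-SCALE `C^{1,1}` BUMP `χ_s` OF ONE BLOCK `Δ(s)` AT def-Y's LETTERS** — dag-n06-h's torus cut-off `B9Ineq346SecondOrderTorusCutoff.cutoffT i.D s`
# read in the hypothesis shapes of files 22∕23∕28 of width seat `pub-ymgap-dag-n06-w1` (`|χ| ≤ 1`, `|∂χ| ≤ 2L^{−lev s}`, `|∂_μ∂_μχ| ≤ 2L^{−2 lev s}` per axis, block
# oscillation `≤ 1`), its plateau on the 2-step stencil of `Δ(s)`, its support in the block ball of radius `r₀ = (d+1)(4L+1)` around `s`, and the LOCALITY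
# consequences for `M_χ`, `∇_U M_χ`, `K(χ)(U)` and the Hessian (file 30 of the seat's set; the geometric layer of the decaying second-order member (β′))

statement-level skeleton of published theorems with citation tags; proofs where landed; nothing here is a claim about the Yang–Mills mass gap

WHY (cell context).  The second-order `L²` member `M_hG′_□M_h∇*_ν∇*_μ` of the Theorem-3.7 walk (dag-n06-k's `L2SecondLegs37.l5`, consumer dag-n06-w7's
`B9Eq346SecondLegAtPinsL2.l2SecondLegs37_memberY_of_hs`) needs a block-to-block DECAYING interior `H²` estimate for the sandwich `w = M_hG′_□M_hΦ`.  File 28 proved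
the GLOBAL estimate by the torus Bochner–Weitzenböck inequality (file 27) applied to `w`; the decaying one (file 31) applies it to `χ_s·w` for the bump `χ_s` of
THIS file: `χ_s = 1` on the stencil of `Δ(s)` (so the Hessians agree on `Δ(s)`), `χ_s = 0` outside the block ball `B(s, r₀)`, and `χ_s` is smooth AT THE BLOCK
SCALE (`|∂χ| ~ L^{−j}`, `|∂∂χ| ~ L^{−2j}`) — a sharp or Lipschitz cut-off would cost `L^{2j}` through `(∂∂χ)·w`.  The bump itself is dag-n06-h g3's (U = 1
second-order programme); nothing is re-derived, only read at def-Y's letters `SiteY ∕ shiftY ∕ blkOf ∕ bondT` and packaged with the block-ball bookkeeping.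

WHAT IS PROVED (sorry-free; 0 `def`; every `i : KIdx`, block `s`; `r₀ := (d+1)(4(ℓ+1)+1)`).
* §1 sizes: `abs_cutoffT_le_one`, `abs_cutoffT_shiftY_sub_le` (`≤ 2(L^{lev s})⁻¹`), `cutoffT_tshift_unit`, ★`abs_cutoffT_second_diff_le` (`≤ 2((L^{lev s})²)⁻¹`, per axis),
  `abs_cutoffT_sub_le_one`;
* §2 plateau ∕ support: `cutoffT_eq_one_of_blkOf_eq`, `cutoffT_shiftY_eq_one_of_blkOf_eq`, `cutoffT_shiftY_shiftY_eq_one_of_blkOf_eq`,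
  `distT_le_of_cutoffT_ne_zero'`, `cutoffT_eq_zero_of_lt_distT`;
* §3 block balls `{z : d(Δ(z), s) ≤ n}`: `lev_shiftY_le`, `distT_blkOf_shiftY_le_one`, `distT_shiftY_le_succ`, `distT_shiftY_symm_le_succ`, `distT_blkOf_stencilY_le_one`, `distT_stencilY_le_succ`, `distT_le_distT_shiftY(_symm)_succ`,
  `distT_sub_le_of_distT_le` (triangle inequality towards a second block `t`);
* §4 locality, for ANY real bump `χ` supported in a block ball `B(s, r)` ∕ equal to `1` on the stencil of `Δ(s)`: `stencil_eq_of_lt_distT`,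
  ★`KhY_apply_eq_zero_of_lt_distT` (`K(χ)(U)Λ = 0` outside `B(s, r+1)`, lit-balaban's `KhY_apply_eq_zero_of_const`), `cutMulY_apply_eq_zero_of_lt_distT`,
  `cdS_cutMulY_apply_eq_zero_of_lt_distT` (outside `B(s, r+1)`), ★`cdS_cdS_cutMulY_apply_eq_of_plateau` (on `Δ(s)` the Hessian of `χ·w` IS the Hessian of `w`);
  the two properties for `χ_s` read as a function on `SiteY i`: `cutoffT_support` (`r = r₀`), `cutoffT_plateau'`.
HONEST SCOPE: lattice bookkeeping over a landed cut-off; no inequality of [B9] is asserted; NOT a node discharge, NOT summit progress; count-neutral; nothing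
continuum ∕ OS ∕ mass gap ∕ Clay; the YM mass gap (Clay) is NOT proved by any of this — R4 closes the conditional finite-𝕋⁴ rung `BalabanLadder.UV` only.  NEW file
importing file 28 (built) and dag-n06-h's `B9Ineq346SecondOrderTorusCutoff` (built).  Net new unproved facts: 0.
-/

noncomputable section

namespace Literature.MathematicalPhysics.QuantumFieldTheory.Balaban1983to89.B9Thm31SiteBlockBumpY

open Literature.MathematicalPhysics.QuantumFieldTheory.Balaban1983to89
open Node00 B6KLevelCensusIndexV1 B6MultiLevelTorusOperator B6GlobalChartV1 B9BackgroundsKLevelV1 B9Eq39Adjoint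
open B6Geom246MultiLevelBox B6Geom246MultiLevelTorus B6MultiLevelBoxOperator B4TorusKernel.MultiPeriod
open Literature.MathematicalPhysics.QuantumFieldTheory.Balaban1983to89.B9Ineq346SecondOrderTorusCutoff (cutoffT cutoffT_nonneg cutoffT_le_one cutoffT_lipschitz
  cutoffT_plateau_shifts cutoffT_tshift distT_le_of_cutoffT_ne_zero side one_le_side ctr cut1 cut1_nonneg cut1_le_one abs_cut1_second_le six_side_le_N0 tentSum
  tentSum_ge tentSum_pos)
open Literature.MathematicalPhysics.QuantumFieldTheory.Balaban1983to89.B9Thm37CubeCoverCommutators (cutMulY cutMulY_apply KhY stencilY KhY_apply_eq_zero_of_const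
  shiftY_mem_stencilY shiftY_symm_mem_stencilY mem_stencilY_of_avgCoeffY_ne_zero)
open Literature.MathematicalPhysics.QuantumFieldTheory.Balaban1983to89.B9Thm311DeltaPrimeSymm (avgCoeffY_eq_ite)
open Literature.MathematicalPhysics.QuantumFieldTheory.Balaban1983to89.B9Thm31SiteGsqBlockDistReg335Y (one_le_RMhP distT_blkOf_shiftY_symm_le_one)
open scoped Matrix

variable {d ℓ : ℕ} {hd : 1 ≤ d + 1} {hL : Odd (ℓ + 1) ∧ 1 < ℓ + 1} {b₀ b₁ : ℝ}
variable (i : KIdx d ℓ hd hL b₀ b₁)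

/-! ## §0 Side conditions at the index -/

/-- `1 ≤ ℓ`, `3 ≤ M_h`, `2L ≤ R`, `4 ≤ P′_μ` at a k-level index (the hypotheses of dag-n06-h's cut-off lemmas). [cite: Balaban1984PropagatorsII, (2.1)–(2.2) p.224, bookkeeping] -/
theorem cutoff_side_conditions : 1 ≤ ℓ ∧ 3 ≤ i.Mh ∧ 2 * (ℓ + 1) ≤ i.R ∧ ∀ μ, 4 ≤ i.P' μ := by
  have h1 := hL.2
  refine ⟨by omega, le_trans (by norm_num) i.hM8, ?_, fun μ => le_trans (by norm_num) (i.hP5 μ)⟩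
  have hR := i.hR2
  have hL1 : 1 ≤ ℓ + 1 := by omega
  calc 2 * (ℓ + 1) = 2 * (ℓ + 1) * 1 := by ring
    _ ≤ 2 * (ℓ + 1) * (ℓ + 1) := Nat.mul_le_mul_left _ hL1
    _ = 2 * (ℓ + 1) ^ 2 := by ring
    _ ≤ i.R := hR

/-- the shift of def-Y's letters is the torus translation by `e_μ`. [cite: Balaban1985BackgroundPropagators, (3.3) p.390, dictionary] -/
theorem shiftY_eq_tshift (μ : Fin (d + 1)) (z : SiteY i) : shiftY i μ z = tshift (N0 ℓ i.Mh i.k i.P') (unitVec μ) z := rfl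

/-- the inverse shift is the translation by `−e_μ`. [cite: Balaban1985BackgroundPropagators, (3.8) p.392, dictionary] -/
theorem shiftY_symm_eq_tshift (μ : Fin (d + 1)) (z : SiteY i) : (shiftY i μ).symm z = tshift (N0 ℓ i.Mh i.k i.P') (-unitVec μ) z :=
  tshift_symm_apply _ _ _

/-- the side of the block `s` is `L^{lev s}`, as a real number. [cite: Balaban1984PropagatorsII, (2.1) p.224, dictionary] -/
theorem side_cast (s : BlkY i) : ((side i.D s : ℕ) : ℝ) = (((ℓ + 1) ^ s.1.1 : ℕ) : ℝ) := rfl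

/-! ## §1 The sizes of `χ_s` in the hypothesis shapes of files 22∕23∕28 -/

section Sizes

variable (s : BlkY i)

/-- `|χ_s| ≤ 1`. [cite: Balaban1985BackgroundPropagators, (3.46) p.398, dictionary] -/
theorem abs_cutoffT_le_one (z : SiteY i) : |cutoffT i.D s z| ≤ 1 := by
  rw [abs_of_nonneg (cutoffT_nonneg i.D s z)]; exact cutoffT_le_one i.D s z

/-- **`|χ_s(z + e_μ) − χ_s(z)| ≤ 2·(L^{lev s})⁻¹`** — the bump is Lipschitz AT THE BLOCK SCALE. [cite: Balaban1985BackgroundPropagators, (3.46) p.398, Cor 3.6 p.408, dictionary] -/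
theorem abs_cutoffT_shiftY_sub_le (μ : Fin (d + 1)) (z : SiteY i) :
    |cutoffT i.D s (shiftY i μ z) - cutoffT i.D s z| ≤ 2 * ((((ℓ + 1) ^ s.1.1 : ℕ) : ℝ))⁻¹ := by
  obtain ⟨_, hMh, hP⟩ := one_le_RMhP i
  rw [shiftY_eq_tshift, ← div_eq_mul_inv, ← side_cast]
  exact cutoffT_lipschitz i.D s hMh hP μ z

/-- a product over the coordinates with one factor changed. [folklore] -/
private theorem prod_update_sub (f : Fin (d + 1) → ℝ) (μ : Fin (d + 1)) (a : ℝ) :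
    (∏ ν, Function.update f μ a ν) - ∏ ν, f ν = (a - f μ) * ∏ ν ∈ Finset.univ.erase μ, f ν := by
  rw [← Finset.mul_prod_erase Finset.univ (Function.update f μ a) (Finset.mem_univ μ),
    ← Finset.mul_prod_erase Finset.univ f (Finset.mem_univ μ), Function.update_self, sub_mul]
  congr 2
  exact Finset.prod_congr rfl fun ν hν => by rw [Function.update_of_ne (Finset.ne_of_mem_erase hν)]

/-- the translate by `ε·e_μ` changes only the `μ`-th factor of the product bump. [cite: Balaban1985BackgroundPropagators, (3.46) p.398, dictionary] -/
theorem cutoffT_tshift_unit (μ : Fin (d + 1)) (ε : ℤ) (z : SiteY i) :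
    cutoffT i.D s (tshift (N0 ℓ i.Mh i.k i.P') (ε • unitVec μ) z)
      = ∏ ν, Function.update (fun ν => cut1 (side i.D s) (N0 ℓ i.Mh i.k i.P' ν) (ctr i.D s ν) (z.1 ν)) μ
          (cut1 (side i.D s) (N0 ℓ i.Mh i.k i.P' μ) (ctr i.D s μ) (z.1 μ + ε)) ν := by
  rw [cutoffT_tshift]
  refine Finset.prod_congr rfl fun ν _ => ?_
  by_cases h : ν = μ
  · subst h; rw [Function.update_self]; simp [unitVec]
  · rw [Function.update_of_ne h]; simp [unitVec, h]

/-- ★ **`|χ_s(z+e_μ) + χ_s(z−e_μ) − 2χ_s(z)| ≤ 2·((L^{lev s})²)⁻¹`** — the per-axis second difference, the `κ₂` of file 23's `hs_KhY_apply_le` (dag-n06-h's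
one-dimensional `abs_cut1_second_le` times a product of factors in `[0, 1]`; `1∕S_n ≤ 2∕(n(n+1)) ≤ 2∕n²`).
[cite: Balaban1985BackgroundPropagators, (3.46) p.398, Cor 3.6 p.408; Balaban1984PropagatorsII, p.247 («|Δh_□| ≤ O(1)(MLʲη)⁻²»), dictionary] -/
theorem abs_cutoffT_second_diff_le (μ : Fin (d + 1)) (z : SiteY i) :
    |cutoffT i.D s (shiftY i μ z) + cutoffT i.D s ((shiftY i μ).symm z) - 2 * cutoffT i.D s z| ≤ 2 * (((((ℓ + 1) ^ s.1.1 : ℕ) : ℝ)) ^ 2)⁻¹ := by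
  obtain ⟨hℓ, hMh3, _, hP4⟩ := cutoff_side_conditions i
  obtain ⟨_, hMh, hP⟩ := one_le_RMhP i
  have hn := one_le_side i.D s
  have hSpos : (0 : ℝ) < tentSum (side i.D s) := by exact_mod_cast tentSum_pos hn
  rw [shiftY_symm_eq_tshift, shiftY_eq_tshift]
  have h1 := cutoffT_tshift_unit i s μ 1 z
  have h2 := cutoffT_tshift_unit i s μ (-1) z
  rw [one_smul] at h1
  rw [neg_one_smul] at h2
  set f : Fin (d + 1) → ℝ := fun ν => cut1 (side i.D s) (N0 ℓ i.Mh i.k i.P' ν) (ctr i.D s ν) (z.1 ν) with hf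
  have e0 : cutoffT i.D s z = ∏ ν, f ν := rfl
  have e : cutoffT i.D s (tshift (N0 ℓ i.Mh i.k i.P') (unitVec μ) z) + cutoffT i.D s (tshift (N0 ℓ i.Mh i.k i.P') (-unitVec μ) z)
      - 2 * cutoffT i.D s z
      = (cut1 (side i.D s) (N0 ℓ i.Mh i.k i.P' μ) (ctr i.D s μ) (z.1 μ + 1) - 2 * f μ
          + cut1 (side i.D s) (N0 ℓ i.Mh i.k i.P' μ) (ctr i.D s μ) (z.1 μ + -1)) * ∏ ν ∈ Finset.univ.erase μ, f ν := by
    have d1 := prod_update_sub f μ (cut1 (side i.D s) (N0 ℓ i.Mh i.k i.P' μ) (ctr i.D s μ) (z.1 μ + 1))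
    have d2 := prod_update_sub f μ (cut1 (side i.D s) (N0 ℓ i.Mh i.k i.P' μ) (ctr i.D s μ) (z.1 μ + -1))
    rw [h1, h2, e0]
    linear_combination d1 + d2
  rw [e, abs_mul]
  have hprod : |∏ ν ∈ Finset.univ.erase μ, f ν| ≤ 1 := by
    rw [abs_of_nonneg (Finset.prod_nonneg fun ν _ => cut1_nonneg _ hn _)]
    exact Finset.prod_le_one (fun ν _ => cut1_nonneg _ hn _) fun ν _ => cut1_le_one _ _
  have hsec := abs_cut1_second_le (N := N0 ℓ i.Mh i.k i.P' μ) (ctr i.D s μ) hn (one_le_N0 (ℓ := ℓ) (k := i.k) hMh hP μ)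
    (six_side_le_N0 i.D s hℓ hMh3 hP4 μ) (z.1 μ)
  rw [show z.1 μ + -1 = z.1 μ - 1 by ring]
  have hS := tentSum_ge (side i.D s)
  have hS' : ((side i.D s : ℕ) : ℝ) * ((side i.D s : ℝ) + 1) ≤ 2 * tentSum (side i.D s) := by exact_mod_cast hS
  have hn' : (1 : ℝ) ≤ side i.D s := by exact_mod_cast hn
  have hkey : 1 / (tentSum (side i.D s) : ℝ) ≤ 2 * (((((ℓ + 1) ^ s.1.1 : ℕ) : ℝ)) ^ 2)⁻¹ := by
    rw [← side_cast, ← one_div, mul_one_div, div_le_div_iff₀ hSpos (by positivity)]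
    nlinarith
  calc _ ≤ 1 / (tentSum (side i.D s) : ℝ) * 1 := mul_le_mul hsec hprod (abs_nonneg _) (by positivity)
    _ ≤ _ := by rw [mul_one]; exact hkey

/-- the block oscillation of `χ_s` is `≤ 1` (values in `[0, 1]`). [cite: Balaban1985BackgroundPropagators, (3.46) p.398, dictionary] -/
theorem abs_cutoffT_sub_le_one (z w : SiteY i) : |cutoffT i.D s z - cutoffT i.D s w| ≤ 1 := by
  have h0 := cutoffT_nonneg i.D s z
  have h1 := cutoffT_le_one i.D s z
  have h0' := cutoffT_nonneg i.D s w
  have h1' := cutoffT_le_one i.D s w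
  rw [abs_le]; constructor <;> linarith

end Sizes

/-! ## §2 Plateau and support -/

section Plateau

variable (s : BlkY i)

/-- `χ_s = 1` on `Δ(s)`. [cite: Balaban1985BackgroundPropagators, (3.46) p.398 («supp h ⊂ Δ̃(y)»), dictionary] -/
theorem cutoffT_eq_one_of_blkOf_eq {z : SiteY i} (hz : blkOf i.D.toDomains z = s) : cutoffT i.D s z = 1 := by
  obtain ⟨_, hMh, hP⟩ := one_le_RMhP i
  exact (cutoffT_plateau_shifts i.D s hMh hP hz 0 0).1

/-- `χ_s(z + e_μ) = 1` for `z ∈ Δ(s)`. [cite: Balaban1985BackgroundPropagators, (3.46) p.398, dictionary] -/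
theorem cutoffT_shiftY_eq_one_of_blkOf_eq {z : SiteY i} (hz : blkOf i.D.toDomains z = s) (μ : Fin (d + 1)) : cutoffT i.D s (shiftY i μ z) = 1 := by
  obtain ⟨_, hMh, hP⟩ := one_le_RMhP i
  rw [shiftY_eq_tshift]
  exact (cutoffT_plateau_shifts i.D s hMh hP hz μ μ).2.1

/-- `χ_s(z + e_μ + e_ν) = 1` for `z ∈ Δ(s)`. [cite: Balaban1985BackgroundPropagators, (3.46) p.398, dictionary] -/
theorem cutoffT_shiftY_shiftY_eq_one_of_blkOf_eq {z : SiteY i} (hz : blkOf i.D.toDomains z = s) (μ ν : Fin (d + 1)) :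
    cutoffT i.D s (shiftY i ν (shiftY i μ z)) = 1 := by
  obtain ⟨_, hMh, hP⟩ := one_le_RMhP i
  rw [shiftY_eq_tshift, shiftY_eq_tshift]
  exact (cutoffT_plateau_shifts i.D s hMh hP hz μ ν).2.2

/-- **THE SUPPORT IN BLOCK TERMS at the index**: `χ_s(z) ≠ 0 ⇒ d(Δ(z), s) ≤ r₀ = (d+1)(4L+1)`. [cite: Balaban1985BackgroundPropagators, (3.46) p.398; Balaban1984PropagatorsII, (2.2) p.224, (2.46) p.231] -/
theorem distT_le_of_cutoffT_ne_zero' {z : SiteY i} (hz : cutoffT i.D s z ≠ 0) :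
    (bondT i.D).dist (blkOf i.D.toDomains z) s ≤ (d + 1) * (4 * (ℓ + 1) + 1) := by
  obtain ⟨hℓ, hMh3, hR, hP4⟩ := cutoff_side_conditions i
  exact distT_le_of_cutoffT_ne_zero i.D s hℓ hMh3 hR hP4 hz

/-- `χ_s = 0` outside the block ball `B(s, r₀)`. [cite: Balaban1985BackgroundPropagators, (3.46) p.398; Balaban1984PropagatorsII, (2.46) p.231] -/
theorem cutoffT_eq_zero_of_lt_distT {z : SiteY i} (hz : (d + 1) * (4 * (ℓ + 1) + 1) < (bondT i.D).dist (blkOf i.D.toDomains z) s) : cutoffT i.D s z = 0 := by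
  by_contra h
  have := distT_le_of_cutoffT_ne_zero' i s h
  omega

end Plateau

/-! ## §3 Block balls: one lattice step, the stencil, the triangle inequality towards a second block -/

section Balls

variable (s : BlkY i)

/-- the block of a forward neighbour is at block distance `≤ 1`. [cite: Balaban1984PropagatorsII, (2.46) p.231, bookkeeping] -/
theorem distT_blkOf_shiftY_le_one (μ : Fin (d + 1)) (z : SiteY i) :
    (bondT i.D).dist (blkOf i.D.toDomains z) (blkOf i.D.toDomains (shiftY i μ z)) ≤ 1 := by
  have h := distT_blkOf_shiftY_symm_le_one i μ (shiftY i μ z)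
  rw [Equiv.symm_apply_apply, SimpleGraph.dist_comm] at h
  exact h

/-- the level of the block of a forward neighbour exceeds the level at the site by at most one ((2.2); companion of file 24's `lev_shiftY_symm_le`).
[cite: Balaban1984PropagatorsII, (2.2) p.224] -/
theorem lev_shiftY_le (μ : Fin (d + 1)) (z : SiteY i) :
    (blkOf i.D.toDomains (shiftY i μ z)).1.1 ≤ (blkOf i.D.toDomains z).1.1 + 1 := by
  obtain ⟨hR, hMh, _⟩ := one_le_RMhP i
  have h1 : torusSupNorm (toKT i).NB (z.1 - (shiftY i μ z).1) ≤ 1 := by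
    have e : shiftY i μ z = tshift (toKT i).NB ((1 : ℤ) • unitVec μ) z := by rw [one_smul]; rfl
    rw [e]; exact B9Thm37CubeCoverCommutatorSizes.torusSupNorm_sub_tshift_le_one z μ 1 (Or.inl rfl)
  have h := B6TorusSiteWalks.lev_le_succ_of_torusSupNorm_le_one i.D hR hMh h1
  have e1 : i.D.lev (shiftY i μ z).1 = (blkOf i.D.toDomains (shiftY i μ z)).1.1 := lev_eq_of_blkOf_eq i.D.toDomains rfl
  have e0 : i.D.lev z.1 = (blkOf i.D.toDomains z).1.1 := lev_eq_of_blkOf_eq i.D.toDomains rfl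
  rw [e1, e0] at h
  exact h

/-- forward neighbours of `B(s, n)` lie in `B(s, n+1)`. [cite: Balaban1984PropagatorsII, (2.46) p.231, (2.54) p.233, bookkeeping] -/
theorem distT_shiftY_le_succ (μ : Fin (d + 1)) (z : SiteY i) :
    (bondT i.D).dist (blkOf i.D.toDomains (shiftY i μ z)) s ≤ (bondT i.D).dist (blkOf i.D.toDomains z) s + 1 := by
  obtain ⟨_, hMh, hP⟩ := one_le_RMhP i
  have htri := (connectedT (D := i.D) hMh hP).dist_triangle (u := blkOf i.D.toDomains (shiftY i μ z)) (v := blkOf i.D.toDomains z) (w := s)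
  have h1 := distT_blkOf_shiftY_le_one i μ z
  rw [SimpleGraph.dist_comm] at h1
  omega

/-- backward neighbours of `B(s, n)` lie in `B(s, n+1)`. [cite: Balaban1984PropagatorsII, (2.46) p.231, (2.54) p.233, bookkeeping] -/
theorem distT_shiftY_symm_le_succ (μ : Fin (d + 1)) (z : SiteY i) :
    (bondT i.D).dist (blkOf i.D.toDomains ((shiftY i μ).symm z)) s ≤ (bondT i.D).dist (blkOf i.D.toDomains z) s + 1 := by
  obtain ⟨_, hMh, hP⟩ := one_le_RMhP i
  have htri := (connectedT (D := i.D) hMh hP).dist_triangle (u := blkOf i.D.toDomains ((shiftY i μ).symm z)) (v := blkOf i.D.toDomains z) (w := s)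
  have h1 := distT_blkOf_shiftY_symm_le_one i μ z
  rw [SimpleGraph.dist_comm] at h1
  omega

/-- the sites of the `K(h)`-stencil of `z` (lattice neighbours and the block of `z`) lie in blocks at distance `≤ 1` from `Δ(z)`.
[cite: Balaban1985BackgroundPropagators, (3.88) p.409, p.410 («semi-local»); Balaban1984PropagatorsII, (2.46) p.231] -/
theorem distT_blkOf_stencilY_le_one (z : SiteY i) {w : SiteY i} (hw : w ∈ stencilY i z) :
    (bondT i.D).dist (blkOf i.D.toDomains z) (blkOf i.D.toDomains w) ≤ 1 := by
  classical
  unfold stencilY at hw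
  simp only [Finset.mem_union, Finset.mem_singleton, Finset.mem_image, Finset.mem_univ, true_and, Finset.mem_filter] at hw
  rcases hw with ((rfl | ⟨μ, rfl⟩) | ⟨μ, rfl⟩) | hw
  · rw [SimpleGraph.dist_self]; exact zero_le_one
  · exact distT_blkOf_shiftY_le_one i μ z
  · exact distT_blkOf_shiftY_symm_le_one i μ z
  · have hb : blkOf i.D.toDomains w = blkOf i.D.toDomains z := by
      by_contra hne
      rw [avgCoeffY_eq_ite, if_neg hne] at hw
      exact hw rfl
    rw [hb, SimpleGraph.dist_self]; exact zero_le_one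

/-- the `K(h)`-stencil of `z` lies in `B(s, d(Δ(z), s) + 1)`, and conversely `d(Δ(z), s) ≤ d(Δ(w), s) + 1` on it.
[cite: Balaban1985BackgroundPropagators, (3.88) p.409, p.410 («semi-local»); Balaban1984PropagatorsII, (2.46) p.231, (2.54) p.233] -/
theorem distT_stencilY_le_succ (z : SiteY i) {w : SiteY i} (hw : w ∈ stencilY i z) :
    (bondT i.D).dist (blkOf i.D.toDomains w) s ≤ (bondT i.D).dist (blkOf i.D.toDomains z) s + 1 ∧
      (bondT i.D).dist (blkOf i.D.toDomains z) s ≤ (bondT i.D).dist (blkOf i.D.toDomains w) s + 1 := by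
  obtain ⟨_, hMh, hP⟩ := one_le_RMhP i
  have h1 := distT_blkOf_stencilY_le_one i z hw
  have h1' : (bondT i.D).dist (blkOf i.D.toDomains w) (blkOf i.D.toDomains z) ≤ 1 := by rw [SimpleGraph.dist_comm]; exact h1
  have htri := (connectedT (D := i.D) hMh hP).dist_triangle (u := blkOf i.D.toDomains w) (v := blkOf i.D.toDomains z) (w := s)
  have htri' := (connectedT (D := i.D) hMh hP).dist_triangle (u := blkOf i.D.toDomains z) (v := blkOf i.D.toDomains w) (w := s)
  constructor <;> omega

/-- one forward lattice step changes the block distance to `s` by at most one, in both directions. [cite: Balaban1984PropagatorsII, (2.46) p.231, (2.54) p.233, bookkeeping] -/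
theorem distT_le_distT_shiftY_succ (μ : Fin (d + 1)) (z : SiteY i) :
    (bondT i.D).dist (blkOf i.D.toDomains z) s ≤ (bondT i.D).dist (blkOf i.D.toDomains (shiftY i μ z)) s + 1 :=
  (distT_stencilY_le_succ i s z (shiftY_mem_stencilY i z μ)).2

/-- one backward lattice step, the same. [cite: Balaban1984PropagatorsII, (2.46) p.231, (2.54) p.233, bookkeeping] -/
theorem distT_le_distT_shiftY_symm_succ (μ : Fin (d + 1)) (z : SiteY i) :
    (bondT i.D).dist (blkOf i.D.toDomains z) s ≤ (bondT i.D).dist (blkOf i.D.toDomains ((shiftY i μ).symm z)) s + 1 :=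
  (distT_stencilY_le_succ i s z (shiftY_symm_mem_stencilY i z μ)).2

/-- **THE TRIANGLE INEQUALITY TOWARDS A SECOND BLOCK**: sites of `B(s, n)` lie in blocks at distance `≥ d(t, s) − n` from `t`.
[cite: Balaban1984PropagatorsII, (2.46) p.231, (2.54) p.233] -/
theorem distT_sub_le_of_distT_le (t : BlkY i) {n : ℕ} {z : SiteY i} (hz : (bondT i.D).dist (blkOf i.D.toDomains z) s ≤ n) :
    (bondT i.D).dist t s - n ≤ (bondT i.D).dist (blkOf i.D.toDomains z) t := by
  obtain ⟨_, hMh, hP⟩ := one_le_RMhP i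
  have htri := (connectedT (D := i.D) hMh hP).dist_triangle (u := t) (v := blkOf i.D.toDomains z) (w := s)
  rw [SimpleGraph.dist_comm (u := t) (v := blkOf i.D.toDomains z)] at htri
  omega

end Balls

/-! ## §4 Locality of `M_χ`, `∇_U M_χ`, `K(χ)(U)` and of the Hessian, for ANY bump `χ` supported in a block ball ∕ flat on the stencil of `Δ(s)` -/

section Locality

variable (s : BlkY i) {𝔸 : Type} [NormedRing 𝔸] [NormedAlgebra ℂ 𝔸] [CompleteSpace 𝔸]

/-- a bump supported in `B(s, r)` is constant (`= 0`) on the whole `K(h)`-stencil of every site outside `B(s, r + 1)`.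
[cite: Balaban1985BackgroundPropagators, (3.88) p.409, p.410; Balaban1984PropagatorsII, (2.46) p.231] -/
theorem stencil_eq_of_lt_distT (χ : SiteY i → ℝ) {r : ℕ} (hχ0 : ∀ z, r < (bondT i.D).dist (blkOf i.D.toDomains z) s → χ z = 0)
    {z : SiteY i} (hz : r + 1 < (bondT i.D).dist (blkOf i.D.toDomains z) s) {w : SiteY i} (hw : w ∈ stencilY i z) : χ w = χ z := by
  have h1 := (distT_stencilY_le_succ i s z hw).2
  rw [hχ0 z (by omega), hχ0 w (by omega)]

/-- ★ **`K(χ)(U)Λ = 0` OUTSIDE `B(s, r + 1)`** for a bump supported in `B(s, r)` (any transporter letter, any `U`, any `Λ`).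
[cite: Balaban1985BackgroundPropagators, (3.88) p.409, p.410 («K(h) is semi-local»)] -/
theorem KhY_apply_eq_zero_of_lt_distT (par : SiteParY 𝔸 i) (U : CfgY 𝔸 i) (χ : SiteY i → ℝ) {r : ℕ}
    (hχ0 : ∀ z, r < (bondT i.D).dist (blkOf i.D.toDomains z) s → χ z = 0) (Λ : SiteY i → 𝔸) {z : SiteY i}
    (hz : r + 1 < (bondT i.D).dist (blkOf i.D.toDomains z) s) : KhY i par χ U Λ z = 0 :=
  KhY_apply_eq_zero_of_const i par _ U Λ z fun _ hw => stencil_eq_of_lt_distT i s χ hχ0 hz hw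

omit [CompleteSpace 𝔸] in
/-- `M_χΛ = 0` outside `B(s, r)`. [cite: Balaban1985BackgroundPropagators, (3.46) p.398, bookkeeping] -/
theorem cutMulY_apply_eq_zero_of_lt_distT (χ : SiteY i → ℝ) {r : ℕ} (hχ0 : ∀ z, r < (bondT i.D).dist (blkOf i.D.toDomains z) s → χ z = 0)
    (Λ : SiteY i → 𝔸) {z : SiteY i} (hz : r < (bondT i.D).dist (blkOf i.D.toDomains z) s) : cutMulY χ Λ z = 0 := by
  rw [cutMulY_apply, hχ0 z hz]; simp

/-- `(∇_{U,μ}M_χΛ)(z) = 0` outside `B(s, r + 1)` (the forward neighbour's block is one bond away). [cite: Balaban1985BackgroundPropagators, (3.3) p.390, (3.46) p.398, bookkeeping] -/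
theorem cdS_cutMulY_apply_eq_zero_of_lt_distT (U : CfgY 𝔸 i) (μ : Fin (d + 1)) (χ : SiteY i → ℝ) {r : ℕ}
    (hχ0 : ∀ z, r < (bondT i.D).dist (blkOf i.D.toDomains z) s → χ z = 0) (Λ : SiteY i → 𝔸) {z : SiteY i}
    (hz : r + 1 < (bondT i.D).dist (blkOf i.D.toDomains z) s) : cdS i U μ (cutMulY χ Λ) z = 0 := by
  have h1 := distT_le_distT_shiftY_succ i s μ z
  show R (UboxY i U μ z) (cutMulY χ Λ (shiftY i μ z)) - cutMulY χ Λ z = 0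
  rw [cutMulY_apply_eq_zero_of_lt_distT i s χ hχ0 Λ (z := z) (by omega),
    cutMulY_apply_eq_zero_of_lt_distT i s χ hχ0 Λ (z := shiftY i μ z) (by omega), R_zero, sub_zero]

/-- ★ **ON `Δ(s)` THE HESSIAN OF `χ·w` IS THE HESSIAN OF `w`** for a bump equal to `1` on the four stencil points `z`, `z+e_μ`, `z+e_ν`, `z+e_μ+e_ν` of every
`z ∈ Δ(s)`: `(∇_μ∇_ν(M_χw))(z) = (∇_μ∇_νw)(z)`. [cite: Balaban1985BackgroundPropagators, (3.3) p.390, (3.46) p.398 (sixth member `∇∇G′`), dictionary] -/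
theorem cdS_cdS_cutMulY_apply_eq_of_plateau (U : CfgY 𝔸 i) (χ : SiteY i → ℝ)
    (hpl : ∀ z, blkOf i.D.toDomains z = s → ∀ μ ν : Fin (d + 1), χ z = 1 ∧ χ (shiftY i μ z) = 1 ∧ χ (shiftY i ν (shiftY i μ z)) = 1)
    (μ ν : Fin (d + 1)) (w : SiteY i → 𝔸) {z : SiteY i} (hz : blkOf i.D.toDomains z = s) :
    cdS i U μ (cdS i U ν (cutMulY χ w)) z = cdS i U μ (cdS i U ν w) z := by
  have e0 := (hpl z hz μ ν).1
  have eμ := (hpl z hz μ ν).2.1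
  have eν := (hpl z hz ν ν).2.1
  have eμν := (hpl z hz μ ν).2.2
  show R (UboxY i U μ z) (R (UboxY i U ν (shiftY i μ z)) (cutMulY χ w (shiftY i ν (shiftY i μ z))) - cutMulY χ w (shiftY i μ z))
      - (R (UboxY i U ν z) (cutMulY χ w (shiftY i ν z)) - cutMulY χ w z)
    = R (UboxY i U μ z) (R (UboxY i U ν (shiftY i μ z)) (w (shiftY i ν (shiftY i μ z))) - w (shiftY i μ z)) - (R (UboxY i U ν z) (w (shiftY i ν z)) - w z)
  simp only [cutMulY_apply, e0, eμ, eν, eμν, Complex.ofReal_one, one_smul]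

/-- dag-n06-h's `χ_s` has the support property with `r = r₀ = (d+1)(4L+1)` … [cite: Balaban1985BackgroundPropagators, (3.46) p.398; Balaban1984PropagatorsII, (2.46) p.231] -/
theorem cutoffT_support : ∀ z : SiteY i, (d + 1) * (4 * (ℓ + 1) + 1) < (bondT i.D).dist (blkOf i.D.toDomains z) s → (fun z : SiteY i => cutoffT i.D s z) z = 0 :=
  fun _ hz => cutoffT_eq_zero_of_lt_distT i s hz

/-- … and the plateau property on the stencil of `Δ(s)`. [cite: Balaban1985BackgroundPropagators, (3.46) p.398 («supp h ⊂ Δ̃(y)»), dictionary] -/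
theorem cutoffT_plateau' : ∀ z : SiteY i, blkOf i.D.toDomains z = s → ∀ μ ν : Fin (d + 1),
    (fun z : SiteY i => cutoffT i.D s z) z = 1 ∧ (fun z : SiteY i => cutoffT i.D s z) (shiftY i μ z) = 1
      ∧ (fun z : SiteY i => cutoffT i.D s z) (shiftY i ν (shiftY i μ z)) = 1 :=
  fun _ hz μ ν => ⟨cutoffT_eq_one_of_blkOf_eq i s hz, cutoffT_shiftY_eq_one_of_blkOf_eq i s hz μ, cutoffT_shiftY_shiftY_eq_one_of_blkOf_eq i s hz μ ν⟩

end Locality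

end Literature.MathematicalPhysics.QuantumFieldTheory.Balaban1983to89.B9Thm31SiteBlockBumpY

end
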